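import Summits.QuantumFields.BalabanUV.Beta.D1BFx.LocalTadpoleRows
import Summits.QuantumFields.BalabanUV.Beta.D1BFx.LatticeHLSPairing
import Summits.QuantumFields.BalabanUV.Beta.D1BFx.NeedleProjProjRow
import Summits.QuantumFields.BalabanUV.Beta.D1BFx.NeedleDipDipLetters

/-!
# `BalabanUV.Beta.D1BFx.LocalTadpoleRowsDecay` — road «BF-x» for binder row D1, slot (K), END rest row, LOCAL GROUP (`RoadEndBFxRows.hGrp_of_rows`,
# hypothesis `hLoc`), «L-TAD-R» GENERIC SIDE: THE GLUON TADPOLE WORDS `Sum.inl (s, r)` OF A SLOT TABLE THAT IS **NOT** FINITELY SUPPORTED IN THE BOND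
# SEPARATION BUT DECAYS EXPONENTIALLY IN IT AT THE BLOCK SCALE — the `hsupp` of `TadpoleRest` ∕ `LocalTadpoleRows` replaced by a displayed decaying
# bi-localisation envelope `|W_s κ u l u′ (x,y)| ≤ Cw·e^{−(θ∕n)‖u−u′‖∞}·e^{−δ(‖x−u‖₁+‖y−u′‖₁)}`; (CONV) and the `hLoc` clause with ONE displayed scalar inequality

HONEST DEPENDENCY (cell records, verbatim): «continuum YM on T⁴ ⇐ BetaPertH ∧ nine spine estimates (0/9 proved); BetaPertH ⇐ (D1) ∧ (D4) ∧
CAP+tail; G-an2-4 gates asym, D1 and NE2/3/4.»  HONEST FRAMING (cell contract, verbatim): «discharging `BetaPertH` makes Bałaban's UV stability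
UNCONDITIONAL — a real constructive-QFT result; it is NOT the continuum limit and NOT the Clay problem.»  THIS MODULE DISCHARGES NOTHING of the wall:
[folklore] bookkeeping BY NAME over `ContactCount.abs_tadpole_le_of_entryBound` (leaf-03), `TadpoleRest.restK_tad_eq_const_mul` ∕ `abs_legPiece_le`,
`LocalTadpoleRows.restK'_inl_eq_restK_inl` ∕ `abs_Ga_le_flatEntry` ∕ `abs_gfrz_le_flatEntry` (this lineage, gen 8: the n-FREE leg entry bound, unconditional),
leaf-04-g9's (1.22) kit `LatticeHLSProfiles.sum_pow_mul_exp_div_nrm_pow_free_scale_le` ∕ `LatticeHLSPairing.abs_fullSum_le_of_abs_sum_le` and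
`LatticeConstantZl.Zl_le_elem`.  The slot tables, the weights and every constant are ARBITRARY sequences; the decay envelope and the scalar inequality are
DISPLAYED, ruled nowhere here; nothing about Bałaban's `WR` is asserted.  No `def`, no `def … : Prop`, nothing cited, 0 sorry.  Root-level binders hW ∕
hR-sockets ∕ hSX-socket ∕ D1Tel ∕ D1Rep — 0 discharged; (K) NOT closed; NOT D1, NOT `BetaPertH`, NOT continuum, NOT Clay.

ABSOLUTE RULE (cell charter, verbatim): «No internally-minted statement may enter as a cited fact. Every hypothesis is either kernel-proved in this
package or a verbatim quotation of a PUBLISHED theorem with page reference. The manuscript(s) under audit are NOT citable for their own disputed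
steps — they are the thing under adjudication; programme-internal (2001/route/tribunal) claims are never citable.»

WHY (owner d1-p2 `HOME/b2b-balaban-beta-d1-p2/K-LOCAL-ROWS.md` v0 §2∕§3 + v0.2 «L-TAD-R (3): open (exponential route)» — «WR = projector second jets: NOT finitely
supported — located: needs the exponential (sharp `decays_Pgt_sup`) route, NOT `hsupp`»; owner d1-p2-g11 2026-08-21T13:33Z «the END's `hGrp_of_rows` then needs
(N) + LOCAL (L-TAD-R∕L-GBUB open, rest ✓) + Λ»; leaf-04-g10 OFFER (α) 13:36Z).  `LocalTadpoleRows` closes the `hLoc` clause of every gluon tadpole word whose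
slot table is finitely supported in the bond separation (`hsupp`, radius `ρ`): then the (1.22) window sum is a finite sum.  For a block-scale table the
window sum must instead be controlled by DECAY in the separation: with the envelope above, the base-point word is `≤ T·e^{−(θ∕n)‖w‖∞}`,
`T = ½·4·(4·C₀·Cw·Zl 4 δ)·Zl 4 δ`, and `Σ_w |w_μw_ν|·e^{−(θ∕n)‖w‖∞} ≤ S₀(θ)·n⁶` (leaf-04-g9's kit), so the row is
`|ωgl|·|c_s|·n⁻⁸·T·S₀(θ)·n⁶` — at a block-scale rate `δ ≥ δ₀∕n` (`Zl 4 δ ≤ (1+2∕δ₀)⁴n⁴`) the UNITS LINE of this word class reads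
`|ωgl n·c_s n|·Cw n·n⁶ ≤ k` (tolerance `n⁻⁶`: the explicit `n⁻⁸`, the two `Zl`'s `n⁸`, the window `n⁶`), with the leg entering through the n-FREE entry
constant `E = cG0 4 + (woodburyDc 0 + ellD0 4 a) + ellD0 4 a` of `LocalTadpoleRows` §3.

CONTENT (all [folklore]).
* §1 generic fibre `F`: **`conv_and_abs_fullSum_tadpoleWord_of_decay`** — (CONV) ∧ `|fullSum (w ↦ c·(w_μw_ν·baseKer (tadpoleTableA A W μ ν) b w))| ≤ |c|·T·S₀(θ)·n⁶`.
* §2 fixed `(n, b)`: **`conv_and_abs_fullSum_restK_tad_of_decay`** (the word `Sum.inl (s, r)`), **`abs_avg_fullSum_restK_tad_le_of_decay`** (base-point average).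
* §3 along `n`, in the END's currency (`restK'`, profile `gfrz n a b`, leg entry bound `E + E`): **`conv_locTad_row_of_decay`**, **`hLoc_tad_of_decay`** (raw displayed
  inequality `hCL`) and **`hLoc_tad_of_decay_scaling`** (rate floor `δ₀∕n ≤ δ n`, letter `|ωgl n·c_s n|·Cw n·n⁶ ≤ k` ⊢ `CL` explicit).
* §4 **`hLoc_tad_of_blockDecay_scaling`** — the same with the envelope in the BLOCK metric `Cw n·e^{−θ·dist(blk u, blk u′)}` (the currency of the projector letters;
  `NeedleDipDipLetters.exp_blockDecay_le_siteDamped` costs `e^{θ}`).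
NOT HERE (honest): that `WR` (or any slot of Bałaban's) satisfies the envelope, and the value of its `Cw n` — (A2)-readout ∕ an2's pins; «L-TAD-E∕J» (gen 8).
Unit `b2b-balaban-beta-d1-formalise-leaf-04` (gen 10), D1 formalisation swarm; `LEAVES-BFx.md` row LOCAL ∕ «L-TAD-R» (generic side).
-/

noncomputable section

namespace Summit.QuantumFields.BalabanUV.Beta.D1BFx.LocalTadpoleRowsDecay

open Finset Filter Topology
open scoped BigOperators
open Literature.MathematicalPhysics.QuantumFieldTheory.Balaban1983to89
open Literature.MathematicalPhysics.QuantumFieldTheory.Balaban1983to89.Beta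
open ExpKernelCalculus (Site MKer BiLoc tadpole Zl Zl_nonneg)
open LatticeConstantZl (Zl_anti Zl_le_elem)
open DyadicShell (Pt toReal)
open PoissonInterior (nrm nrm_pos supNorm)
open WindowIdentification (psum fullSum)
open DressedMomentNormalisation (resSite)
open LongitudinalWindow (ellD0)
open WoodburyCovariant (woodburyDc)
open VectorLegVolumeAdapter (woodburyDc_zero_nonneg)
open Summit.QuantumFields.BalabanUV.Beta.D1BFx.MomentTransferPeriodic (baseKer)
open Summit.QuantumFields.BalabanUV.Beta.D1BFx.ReducedKernel (TableR)
open Summit.QuantumFields.BalabanUV.Beta.D1BFx.DressedTablesLeg (tadpoleTableA tadpoleTableA_apply)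
open Summit.QuantumFields.BalabanUV.Beta.D1BFx.ContactCount (abs_tadpole_le_of_entryBound abs_sum_mul_le_of_convex)
open Summit.QuantumFields.BalabanUV.Beta.D1BFx.Assembly (sum_uniform_resSite uniform_resSite_nonneg)
open Summit.QuantumFields.BalabanUV.Beta.D1BFx.FineHessianSectors (slotWt slotTab)
open Summit.QuantumFields.BalabanUV.Beta.D1BFx.FineHessianLegGrades (legPiece)
open Summit.QuantumFields.BalabanUV.Beta.D1BFx.FrozenLegProfile (gfrz)
open Summit.QuantumFields.BalabanUV.Beta.D1BFx.SplitInstance (RestIdx restK restK_tad)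
open Summit.QuantumFields.BalabanUV.Beta.D1BFx.SplitRecut (restK' restK'_tad)
open Summit.QuantumFields.BalabanUV.Beta.D1BFx.TadpoleRest (restK_tad_eq_const_mul abs_legPiece_le)
open Summit.QuantumFields.BalabanUV.Beta.D1BFx.LocalTadpoleRows (restK'_inl_eq_restK_inl abs_Ga_le_flatEntry abs_gfrz_le_flatEntry)
open Summit.QuantumFields.BalabanUV.Beta.D1BFx.OffDiagonalLegGrade (ellD0_nonneg)
open Summit.QuantumFields.BalabanUV.Beta.D1BFx.PointColumnSplit (cG0 cG0_nonneg)
open Summit.QuantumFields.BalabanUV.Beta.D1BFx.LatticeHLSProfiles (sum_pow_mul_exp_div_nrm_pow_free_scale_le supNorm_dyadic)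
open Summit.QuantumFields.BalabanUV.Beta.D1BFx.LatticeHLSPairing (abs_fullSum_le_of_abs_sum_le)
open Summit.QuantumFields.BalabanUV.Beta.D1BFx.NeedleProjProjRow (abs_weight_le_sq)
open Summit.QuantumFields.BalabanUV.Beta.D1BFx.NeedleDipDipLetters (exp_blockDecay_le_siteDamped)
open B6QGQLower276 (blk)

/-! ## §1 The generic tadpole word with a decaying bond-separation envelope -/

section Generic

variable {F : Type*} [Fintype F] {A : MKer 4 F} {W : Fin 4 → Site 4 → Fin 4 → Site 4 → MKer 4 F} {C₀ Cw δ θ : ℝ} {n : ℕ}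

/-- [folklore] **THE GENERIC TADPOLE WORD UNDER A DECAYING ENVELOPE — (CONV) AND THE WEIGHTED FULL SUM.**  Entry-bounded leg `|A| ≤ C₀` (`C₀ ≥ 0`); the table
bi-localised at its two bonds at rate `δ > 0` with a constant that DECAYS in the bond separation at the block scale,
`BiLoc (W κ u l u′) u u′ (Cw·e^{−(θ∕n)‖u−u′‖∞}) δ` (`Cw ≥ 0`, `θ > 0`, `n ≥ 1`) ⟹ the punctured partial sums of `w ↦ c·(w_μw_ν·baseKer (tadpoleTableA A W μ ν) b w)`
converge and `|fullSum| ≤ |c|·(½·|F|·(|F|·C₀·Cw·Zl 4 δ)·Zl 4 δ)·S₀(θ)·n⁶`, `S₀(θ)·n⁶ = 2·2!·(2∕θ)²·(1 + 216·(3!·(4∕θ)³·(1+4∕θ)))·n⁶`, at EVERY base site. -/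
theorem conv_and_abs_fullSum_tadpoleWord_of_decay (hn : 1 ≤ n) (hC₀ : 0 ≤ C₀) (hCw : 0 ≤ Cw) (hδ : 0 < δ) (hθ : 0 < θ)
    (hA : ∀ x y a b, |A x y a b| ≤ C₀) (hW : ∀ κ u l u', BiLoc (W κ u l u') u u' (Cw * Real.exp (-(θ / n) * supNorm (u - u'))) δ)
    (c : ℝ) (μ ν : Fin 4) (b : Pt) :
    (∃ B, Tendsto (psum (fun w : Pt => c * (toReal w μ * toReal w ν * baseKer (tadpoleTableA A W μ ν) b w))) atTop (𝓝 B)) ∧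
      |fullSum (fun w : Pt => c * (toReal w μ * toReal w ν * baseKer (tadpoleTableA A W μ ν) b w))| ≤
        |c| * ((1 / 2 : ℝ) * ((Fintype.card F : ℝ) * ((Fintype.card F : ℝ) * (C₀ * Cw) * Zl 4 δ) * Zl 4 δ)) *
          (2 * (2 : ℕ).factorial * (2 / θ) ^ 2 * (1 + 2 * (4 : ℕ) * 3 ^ (4 - 1) * ((4 - 1 - 0).factorial * (4 / θ) ^ (4 - 1 - 0) * (1 + 4 / θ)))
            * (n : ℝ) ^ (4 - 0 + 2)) := by
  have hZ : 0 ≤ Zl 4 δ := Zl_nonneg hδ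
  have hT : 0 ≤ (1 / 2 : ℝ) * ((Fintype.card F : ℝ) * ((Fintype.card F : ℝ) * (C₀ * Cw) * Zl 4 δ) * Zl 4 δ) := by positivity
  -- the base-point word decays in the displacement
  have hpt : ∀ w : Pt, |baseKer (tadpoleTableA A W μ ν) b w| ≤
      (1 / 2 : ℝ) * ((Fintype.card F : ℝ) * ((Fintype.card F : ℝ) * (C₀ * Cw) * Zl 4 δ) * Zl 4 δ) * Real.exp (-(θ / n) * supNorm (d := 4) w) := by
    intro w
    rw [baseKer, tadpoleTableA_apply, abs_mul, abs_of_pos (by norm_num : (0 : ℝ) < 1 / 2)]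
    have h := abs_tadpole_le_of_entryBound hC₀ hA (hW μ (b + w) ν b) hδ
    rw [add_sub_cancel_left] at h
    refine (mul_le_mul_of_nonneg_left h (by norm_num)).trans (le_of_eq ?_)
    ring
  refine abs_fullSum_le_of_abs_sum_le fun S => ?_
  have hkit := sum_pow_mul_exp_div_nrm_pow_free_scale_le (d := 4) (by norm_num) hθ hn (p := 0) (by norm_num) 2 S 0 0
  simp only [sub_zero] at hkit
  have hptS : ∀ w ∈ S, |c * (toReal w μ * toReal w ν * baseKer (tadpoleTableA A W μ ν) b w)| ≤
      |c| * ((1 / 2 : ℝ) * ((Fintype.card F : ℝ) * ((Fintype.card F : ℝ) * (C₀ * Cw) * Zl 4 δ) * Zl 4 δ)) *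
        (((supNorm (d := 4) w : ℕ) : ℝ) ^ 2 * Real.exp (-(θ / n) * supNorm (d := 4) w) / nrm (d := 4) w ^ 0) := by
    intro w _
    have hw := abs_weight_le_sq w μ ν
    rw [supNorm_dyadic] at hw
    rw [abs_mul, abs_mul, pow_zero, div_one]
    calc |c| * (|toReal w μ * toReal w ν| * |baseKer (tadpoleTableA A W μ ν) b w|)
        ≤ |c| * (((supNorm (d := 4) w : ℕ) : ℝ) ^ 2 * ((1 / 2 : ℝ) * ((Fintype.card F : ℝ) * ((Fintype.card F : ℝ) * (C₀ * Cw) * Zl 4 δ) * Zl 4 δ) *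
            Real.exp (-(θ / n) * supNorm (d := 4) w))) :=
          mul_le_mul_of_nonneg_left (mul_le_mul hw (hpt w) (abs_nonneg _) (by positivity)) (abs_nonneg c)
      _ = _ := by ring
  calc ∑ w ∈ S, |c * (toReal w μ * toReal w ν * baseKer (tadpoleTableA A W μ ν) b w)|
      ≤ ∑ w ∈ S, |c| * ((1 / 2 : ℝ) * ((Fintype.card F : ℝ) * ((Fintype.card F : ℝ) * (C₀ * Cw) * Zl 4 δ) * Zl 4 δ)) *
          (((supNorm (d := 4) w : ℕ) : ℝ) ^ 2 * Real.exp (-(θ / n) * supNorm (d := 4) w) / nrm (d := 4) w ^ 0) := Finset.sum_le_sum hptS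
    _ = |c| * ((1 / 2 : ℝ) * ((Fintype.card F : ℝ) * ((Fintype.card F : ℝ) * (C₀ * Cw) * Zl 4 δ) * Zl 4 δ)) *
          ∑ w ∈ S, ((supNorm (d := 4) w : ℕ) : ℝ) ^ 2 * Real.exp (-(θ / n) * supNorm (d := 4) w) / nrm (d := 4) w ^ 0 := by rw [Finset.mul_sum]
    _ ≤ _ := mul_le_mul_of_nonneg_left hkit (by positivity)

end Generic

/-! ## §2 The gluon tadpole word `Sum.inl (s, r)` at fixed block size under the decaying envelope -/

section Fixed

variable (n : ℕ) [NeZero n] (a : ℝ) (cE cΛ cR cK cQ cE₂ cJ4 cΛ₂ cR₂ cQ₂ x₀ : ℝ) (WE WJ WΛ WR WQ : TableR) (ωgl ωgh lam N : ℝ)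
  (μ ν : Fin 4) {C₀ Cw δ θ : ℝ}

/-- [folklore] **THE WORD `(s, r)` AT FIXED `(n, b)` UNDER THE DECAYING ENVELOPE**: leg piece `r` entry-bounded by `C₀ ≥ 0`, slot table `s` with
`BiLoc (W_s κ u l u′) u u′ (Cw·e^{−(θ∕n)‖u−u′‖∞}) δ` ⟹ (CONV) of `restK … (Sum.inl (s,r))` at the base site `b` and
`|fullSum| ≤ |ω_gl|·|c_s|·n⁻⁸·(½·4·(4·C₀·Cw·Zl 4 δ)·Zl 4 δ)·S₀(θ)·n⁶`. -/
theorem conv_and_abs_fullSum_restK_tad_of_decay {g : Pt → ℝ} (b : Pt) (x : Fin 5 × Fin 3) (hn : 1 ≤ n) (hC₀ : 0 ≤ C₀) (hCw : 0 ≤ Cw)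
    (hδ : 0 < δ) (hθ : 0 < θ) (hA : ∀ x' y κ l, |legPiece n a g x.2 x' y κ l| ≤ C₀)
    (hW : ∀ κ u l u', BiLoc (slotTab WE WJ WΛ WR WQ x.1 κ u l u') u u' (Cw * Real.exp (-(θ / n) * supNorm (u - u'))) δ) :
    (∃ B, Tendsto (psum (restK n a g cE cΛ cR cK cQ cE₂ cJ4 cΛ₂ cR₂ cQ₂ x₀ WE WJ WΛ WR WQ ωgl ωgh lam N μ ν b (Sum.inl x))) atTop (𝓝 B)) ∧
      |fullSum (restK n a g cE cΛ cR cK cQ cE₂ cJ4 cΛ₂ cR₂ cQ₂ x₀ WE WJ WΛ WR WQ ωgl ωgh lam N μ ν b (Sum.inl x))| ≤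
        |ωgl| * |slotWt cE₂ cJ4 cΛ₂ cR₂ cQ₂ x.1| * ((n : ℝ) ^ 8)⁻¹ * ((1 / 2 : ℝ) * ((4 : ℝ) * ((4 : ℝ) * (C₀ * Cw) * Zl 4 δ) * Zl 4 δ)) *
          (2 * (2 : ℕ).factorial * (2 / θ) ^ 2 * (1 + 2 * (4 : ℕ) * 3 ^ (4 - 1) * ((4 - 1 - 0).factorial * (4 / θ) ^ (4 - 1 - 0) * (1 + 4 / θ)))
            * (n : ℝ) ^ (4 - 0 + 2)) := by
  have h := conv_and_abs_fullSum_tadpoleWord_of_decay hn hC₀ hCw hδ hθ hA hW (ωgl * slotWt cE₂ cJ4 cΛ₂ cR₂ cQ₂ x.1 * ((n : ℝ) ^ 8)⁻¹) μ ν b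
  rw [restK_tad_eq_const_mul]
  simp only [Fintype.card_fin, Nat.cast_ofNat] at h
  rwa [abs_mul, abs_mul, abs_of_nonneg (by positivity : (0 : ℝ) ≤ ((n : ℝ) ^ 8)⁻¹)] at h

/-- [folklore] **BASE-POINT AVERAGED** (the END's `Σ_{b ∈ image resSite} n⁻⁴` is convex): the same bound for `|Σ_b n⁻⁴·fullSum (restK … (gb b) … b (Sum.inl (s,r)))|`,
for any site-dependent profile `gb` whose leg pieces are entry-bounded by `C₀` uniformly in `b`. -/
theorem abs_avg_fullSum_restK_tad_le_of_decay {gb : Pt → Pt → ℝ} (x : Fin 5 × Fin 3) (hn : 1 ≤ n) (hC₀ : 0 ≤ C₀) (hCw : 0 ≤ Cw)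
    (hδ : 0 < δ) (hθ : 0 < θ) (hA : ∀ b x' y κ l, |legPiece n a (gb b) x.2 x' y κ l| ≤ C₀)
    (hW : ∀ κ u l u', BiLoc (slotTab WE WJ WΛ WR WQ x.1 κ u l u') u u' (Cw * Real.exp (-(θ / n) * supNorm (u - u'))) δ) :
    |∑ b ∈ (univ : Finset (Fin 4 → Fin n)).image resSite, ((n : ℝ) ^ 4)⁻¹ *
        fullSum (restK n a (gb b) cE cΛ cR cK cQ cE₂ cJ4 cΛ₂ cR₂ cQ₂ x₀ WE WJ WΛ WR WQ ωgl ωgh lam N μ ν b (Sum.inl x))| ≤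
      |ωgl| * |slotWt cE₂ cJ4 cΛ₂ cR₂ cQ₂ x.1| * ((n : ℝ) ^ 8)⁻¹ * ((1 / 2 : ℝ) * ((4 : ℝ) * ((4 : ℝ) * (C₀ * Cw) * Zl 4 δ) * Zl 4 δ)) *
        (2 * (2 : ℕ).factorial * (2 / θ) ^ 2 * (1 + 2 * (4 : ℕ) * 3 ^ (4 - 1) * ((4 - 1 - 0).factorial * (4 / θ) ^ (4 - 1 - 0) * (1 + 4 / θ)))
          * (n : ℝ) ^ (4 - 0 + 2)) :=
  abs_sum_mul_le_of_convex _ (fun b hb => uniform_resSite_nonneg n b hb) (sum_uniform_resSite (NeZero.ne n))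
    fun b _ => (conv_and_abs_fullSum_restK_tad_of_decay n a cE cΛ cR cK cQ cE₂ cJ4 cΛ₂ cR₂ cQ₂ x₀ WE WJ WΛ WR WQ ωgl ωgh lam N μ ν b x hn hC₀ hCw hδ hθ
      (hA b) hW).2

end Fixed

/-! ## §3 Along the block sizes: the `hLoc` clause under the decaying envelope -/

section Along

variable {a N : ℝ} {μ ν : Fin 4} {cE cΛ cR cK cQ cE₂ cJ4 cΛ₂ cR₂ cQ₂ x₀ ωgl ωgh : ℕ → ℝ} {WE WJ WΛ WR WQ : ℕ → TableR}
  {Cw δ : ℕ → ℝ} {θ CL : ℝ}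

/-- [folklore] **(CONV) OF THE TADPOLE WORD `Sum.inl (s, r)` IN THE END's CURRENCY FROM THE DECAYING ENVELOPE** (profile = the road's `gfrz n a b`; the leg
enters through the n-free entry constant `E`, used only qualitatively here). -/
theorem conv_locTad_row_of_decay (x : Fin 5 × Fin 3) (ha : 0 < a) (hθ : 0 < θ) (hδ : ∀ n, 0 < δ n) (hCw : ∀ n, 0 ≤ Cw n)
    (hW : ∀ n κ u l u', BiLoc (slotTab (WE n) (WJ n) (WΛ n) (WR n) (WQ n) x.1 κ u l u') u u' (Cw n * Real.exp (-(θ / n) * supNorm (u - u'))) (δ n))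
    (n : ℕ) [NeZero n] (b : Pt) :
    ∃ B, Tendsto (psum (fun w : Pt => restK' n a (gfrz n a b) (cE n) (cΛ n) (cR n) (cK n) (cQ n) (cE₂ n) (cJ4 n) (cΛ₂ n) (cR₂ n) (cQ₂ n) (x₀ n)
      (WE n) (WJ n) (WΛ n) (WR n) (WQ n) (ωgl n) (ωgh n) ((n : ℝ) ^ 8) N μ ν b (Sum.inl x) w)) atTop (𝓝 B) := by
  have hn : 1 ≤ n := NeZero.one_le
  have hE0 : 0 ≤ (cG0 4 + (woodburyDc 0 + ellD0 4 a) + ellD0 4 a) + (cG0 4 + (woodburyDc 0 + ellD0 4 a) + ellD0 4 a) := by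
    have h1 := cG0_nonneg 4
    have h2 := woodburyDc_zero_nonneg
    have h3 := ellD0_nonneg (d := 4) ha
    positivity
  have e : (fun w : Pt => restK' n a (gfrz n a b) (cE n) (cΛ n) (cR n) (cK n) (cQ n) (cE₂ n) (cJ4 n) (cΛ₂ n) (cR₂ n) (cQ₂ n) (x₀ n)
      (WE n) (WJ n) (WΛ n) (WR n) (WQ n) (ωgl n) (ωgh n) ((n : ℝ) ^ 8) N μ ν b (Sum.inl x) w)
      = restK n a (gfrz n a b) (cE n) (cΛ n) (cR n) (cK n) (cQ n) (cE₂ n) (cJ4 n) (cΛ₂ n) (cR₂ n) (cQ₂ n) (x₀ n)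
        (WE n) (WJ n) (WΛ n) (WR n) (WQ n) (ωgl n) (ωgh n) ((n : ℝ) ^ 8) N μ ν b (Sum.inl x) := by
    funext w
    exact restK'_inl_eq_restK_inl n a (cE n) (cΛ n) (cR n) (cK n) (cQ n) (cE₂ n) (cJ4 n) (cΛ₂ n) (cR₂ n) (cQ₂ n) (x₀ n) (WE n) (WJ n) (WΛ n)
      (WR n) (WQ n) (ωgl n) (ωgh n) ((n : ℝ) ^ 8) N μ ν (gfrz n a b) b x w
  rw [e]
  exact (conv_and_abs_fullSum_restK_tad_of_decay n a (cE n) (cΛ n) (cR n) (cK n) (cQ n) (cE₂ n) (cJ4 n) (cΛ₂ n) (cR₂ n) (cQ₂ n) (x₀ n) (WE n) (WJ n)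
    (WΛ n) (WR n) (WQ n) (ωgl n) (ωgh n) ((n : ℝ) ^ 8) N μ ν b x hn hE0 (hCw n) (hδ n) hθ
    (fun x' y κ l => abs_legPiece_le n a (fun x'' y' κ' l' => abs_Ga_le_flatEntry n ha x'' y' κ' l') (fun v => abs_gfrz_le_flatEntry n ha b v)
      x.2 x' y κ l) (hW n)).1

/-- [folklore] **«L-TAD» UNDER THE DECAYING ENVELOPE: THE `hLoc` CLAUSE OF A GLUON TADPOLE WORD `Sum.inl (s, r)`** — displayed, for every block size: the
decaying bi-localisation of slot `s` (`hW`, with `Cw n ≥ 0`, `δ n > 0`, block-scale separation rate `θ∕n`, `θ > 0`) and ONE scalar inequality `hCL` on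
`ωgl n`, `c_s n`, `Cw n`, `Zl 4 (δ n)` and the n-free leg entry constant `E + E` (slot (K)'s units; ruled nowhere here).  Output = the `τ := Sum.inl (s, r)`
instance of `RoadEndBFxRows.hGrp_of_rows`' hypothesis `hLoc`, VERBATIM. -/
theorem hLoc_tad_of_decay (x : Fin 5 × Fin 3) (ha : 0 < a) (hθ : 0 < θ) (hδ : ∀ n, 0 < δ n) (hCw : ∀ n, 0 ≤ Cw n)
    (hW : ∀ n κ u l u', BiLoc (slotTab (WE n) (WJ n) (WΛ n) (WR n) (WQ n) x.1 κ u l u') u u' (Cw n * Real.exp (-(θ / n) * supNorm (u - u'))) (δ n))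
    (hCL : ∀ n : ℕ, 2 ≤ n → |ωgl n| * |slotWt (cE₂ n) (cJ4 n) (cΛ₂ n) (cR₂ n) (cQ₂ n) x.1| * ((n : ℝ) ^ 8)⁻¹ * ((1 / 2 : ℝ) * ((4 : ℝ) * ((4 : ℝ) *
        (((cG0 4 + (woodburyDc 0 + ellD0 4 a) + ellD0 4 a) + (cG0 4 + (woodburyDc 0 + ellD0 4 a) + ellD0 4 a)) * Cw n) * Zl 4 (δ n)) * Zl 4 (δ n))) *
        (2 * (2 : ℕ).factorial * (2 / θ) ^ 2 * (1 + 2 * (4 : ℕ) * 3 ^ (4 - 1) * ((4 - 1 - 0).factorial * (4 / θ) ^ (4 - 1 - 0) * (1 + 4 / θ)))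
          * (n : ℝ) ^ (4 - 0 + 2)) ≤ CL) :
    ∀ n : ℕ, 2 ≤ n → ∀ [NeZero n],
      |∑ b ∈ (univ : Finset (Fin 4 → Fin n)).image resSite, ((n : ℝ) ^ 4)⁻¹ *
        fullSum (fun w : Pt => restK' n a (gfrz n a b) (cE n) (cΛ n) (cR n) (cK n) (cQ n) (cE₂ n) (cJ4 n) (cΛ₂ n) (cR₂ n) (cQ₂ n) (x₀ n)
          (WE n) (WJ n) (WΛ n) (WR n) (WQ n) (ωgl n) (ωgh n) ((n : ℝ) ^ 8) N μ ν b (Sum.inl x) w)| ≤ CL := by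
  intro n hn _
  have hn1 : 1 ≤ n := le_trans one_le_two hn
  have hE0 : 0 ≤ (cG0 4 + (woodburyDc 0 + ellD0 4 a) + ellD0 4 a) + (cG0 4 + (woodburyDc 0 + ellD0 4 a) + ellD0 4 a) := by
    have h1 := cG0_nonneg 4
    have h2 := woodburyDc_zero_nonneg
    have h3 := ellD0_nonneg (d := 4) ha
    positivity
  have e : ∀ b : Pt, (fun w : Pt => restK' n a (gfrz n a b) (cE n) (cΛ n) (cR n) (cK n) (cQ n) (cE₂ n) (cJ4 n) (cΛ₂ n) (cR₂ n) (cQ₂ n) (x₀ n)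
      (WE n) (WJ n) (WΛ n) (WR n) (WQ n) (ωgl n) (ωgh n) ((n : ℝ) ^ 8) N μ ν b (Sum.inl x) w)
      = restK n a (gfrz n a b) (cE n) (cΛ n) (cR n) (cK n) (cQ n) (cE₂ n) (cJ4 n) (cΛ₂ n) (cR₂ n) (cQ₂ n) (x₀ n)
        (WE n) (WJ n) (WΛ n) (WR n) (WQ n) (ωgl n) (ωgh n) ((n : ℝ) ^ 8) N μ ν b (Sum.inl x) := by
    intro b; funext w
    exact restK'_inl_eq_restK_inl n a (cE n) (cΛ n) (cR n) (cK n) (cQ n) (cE₂ n) (cJ4 n) (cΛ₂ n) (cR₂ n) (cQ₂ n) (x₀ n) (WE n) (WJ n) (WΛ n)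
      (WR n) (WQ n) (ωgl n) (ωgh n) ((n : ℝ) ^ 8) N μ ν (gfrz n a b) b x w
  simp only [e]
  exact (abs_avg_fullSum_restK_tad_le_of_decay n a (cE n) (cΛ n) (cR n) (cK n) (cQ n) (cE₂ n) (cJ4 n) (cΛ₂ n) (cR₂ n) (cQ₂ n) (x₀ n) (WE n) (WJ n)
    (WΛ n) (WR n) (WQ n) (ωgl n) (ωgh n) ((n : ℝ) ^ 8) N μ ν x hn1 hE0 (hCw n) (hδ n) hθ
    (fun b x' y κ l => abs_legPiece_le n a (fun x'' y' κ' l' => abs_Ga_le_flatEntry n ha x'' y' κ' l') (fun v => abs_gfrz_le_flatEntry n ha b v)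
      x.2 x' y κ l) (hW n)).trans (hCL n hn)

/-- [folklore] **«L-TAD» UNDER THE DECAYING ENVELOPE WITH THE n-POWER LEDGER EXPLICIT — TOLERANCE `n⁻⁶`**: at a block-scale rate floor `δ₀∕n ≤ δ n`
(`δ₀ > 0`, `δ n > 0`; `Zl 4 (δ n) ≤ (1 + 2∕δ₀)⁴·n⁴` by `Zl_anti` ∕ `Zl_le_elem`) and under the scaling letter `|ωgl n·c_s n|·Cw n·n⁶ ≤ k` (`n ≥ 2`), the `hLoc`
clause of `Sum.inl (s, r)` holds with `CL := k·(E + E)·(8·(1+2∕δ₀)⁸)·S₀(θ)`, `E = cG0 4 + (woodburyDc 0 + ellD0 4 a) + ellD0 4 a`,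
`S₀(θ) = 2·2!·(2∕θ)²·(1 + 216·(3!·(4∕θ)³·(1+4∕θ)))` — the explicit `n⁻⁸`, the two `Zl`'s `n⁸` and the window `n⁶` leave `n⁻⁶` for `|ωgl·c_s|·Cw`. -/
theorem hLoc_tad_of_decay_scaling (x : Fin 5 × Fin 3) (ha : 0 < a) (hθ : 0 < θ) (hδ : ∀ n, 0 < δ n) {δ₀ k : ℝ} (hδ₀ : 0 < δ₀)
    (hδge : ∀ n : ℕ, δ₀ / n ≤ δ n) (hCw : ∀ n, 0 ≤ Cw n)
    (hW : ∀ n κ u l u', BiLoc (slotTab (WE n) (WJ n) (WΛ n) (WR n) (WQ n) x.1 κ u l u') u u' (Cw n * Real.exp (-(θ / n) * supNorm (u - u'))) (δ n))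
    (hk : ∀ n : ℕ, 2 ≤ n → |ωgl n * slotWt (cE₂ n) (cJ4 n) (cΛ₂ n) (cR₂ n) (cQ₂ n) x.1| * Cw n * (n : ℝ) ^ 6 ≤ k) :
    ∀ n : ℕ, 2 ≤ n → ∀ [NeZero n],
      |∑ b ∈ (univ : Finset (Fin 4 → Fin n)).image resSite, ((n : ℝ) ^ 4)⁻¹ *
        fullSum (fun w : Pt => restK' n a (gfrz n a b) (cE n) (cΛ n) (cR n) (cK n) (cQ n) (cE₂ n) (cJ4 n) (cΛ₂ n) (cR₂ n) (cQ₂ n) (x₀ n)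
          (WE n) (WJ n) (WΛ n) (WR n) (WQ n) (ωgl n) (ωgh n) ((n : ℝ) ^ 8) N μ ν b (Sum.inl x) w)| ≤
        k * ((cG0 4 + (woodburyDc 0 + ellD0 4 a) + ellD0 4 a) + (cG0 4 + (woodburyDc 0 + ellD0 4 a) + ellD0 4 a)) * (8 * (1 + 2 / δ₀) ^ 8) *
          (2 * (2 : ℕ).factorial * (2 / θ) ^ 2 * (1 + 2 * (4 : ℕ) * 3 ^ (4 - 1) * ((4 - 1 - 0).factorial * (4 / θ) ^ (4 - 1 - 0) * (1 + 4 / θ)))) := by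
  refine hLoc_tad_of_decay x ha hθ hδ hCw hW (fun n hn => ?_)
  have hn1 : 1 ≤ n := le_trans one_le_two hn
  have hn0 : (0 : ℝ) < n := by exact_mod_cast (lt_of_lt_of_le zero_lt_one hn1)
  have hnR : (1 : ℝ) ≤ n := by exact_mod_cast hn1
  have hnz : (n : ℝ) ≠ 0 := hn0.ne'
  set E : ℝ := (cG0 4 + (woodburyDc 0 + ellD0 4 a) + ellD0 4 a) + (cG0 4 + (woodburyDc 0 + ellD0 4 a) + ellD0 4 a) with hEdef
  set S : ℝ := 2 * (2 : ℕ).factorial * (2 / θ) ^ 2 * (1 + 2 * (4 : ℕ) * 3 ^ (4 - 1) * ((4 - 1 - 0).factorial * (4 / θ) ^ (4 - 1 - 0) * (1 + 4 / θ)))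
    with hSdef
  have hE0 : 0 ≤ E := by
    have h1 := cG0_nonneg 4
    have h2 := woodburyDc_zero_nonneg
    have h3 := ellD0_nonneg (d := 4) ha
    positivity
  have hS0 : 0 ≤ S := by positivity
  have hCwn := hCw n
  have hkn := hk n hn
  have hk0 : 0 ≤ k := le_trans (by positivity) hkn
  -- the two Zl's at the block scale
  have hZ0 : 0 ≤ Zl 4 (δ n) := Zl_nonneg (hδ n)
  have hZ1 : Zl 4 (δ n) ≤ (1 + 2 / δ₀) ^ 4 * (n : ℝ) ^ 4 := by
    have h1 : Zl 4 (δ n) ≤ Zl 4 (δ₀ / n) := Zl_anti (div_pos hδ₀ hn0) (hδge n)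
    have h2 : Zl 4 (δ₀ / n) ≤ (1 + 2 / (δ₀ / n)) ^ 4 := Zl_le_elem (div_pos hδ₀ hn0) 4
    have h3 : 1 + 2 / (δ₀ / (n : ℝ)) ≤ (1 + 2 / δ₀) * n := by
      rw [div_div_eq_mul_div, add_mul, one_mul]
      have e : (2 : ℝ) * n / δ₀ = 2 / δ₀ * n := by ring
      rw [e]
      linarith
    have h4 : (0 : ℝ) ≤ 1 + 2 / (δ₀ / n) := by positivity
    calc Zl 4 (δ n) ≤ (1 + 2 / (δ₀ / n)) ^ 4 := h1.trans h2
      _ ≤ ((1 + 2 / δ₀) * n) ^ 4 := pow_le_pow_left₀ h4 h3 4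
      _ = (1 + 2 / δ₀) ^ 4 * (n : ℝ) ^ 4 := by ring
  have hZsq : Zl 4 (δ n) * Zl 4 (δ n) ≤ ((1 + 2 / δ₀) ^ 4 * (n : ℝ) ^ 4) * ((1 + 2 / δ₀) ^ 4 * (n : ℝ) ^ 4) :=
    mul_le_mul hZ1 hZ1 hZ0 (by positivity)
  have e : |ωgl n| * |slotWt (cE₂ n) (cJ4 n) (cΛ₂ n) (cR₂ n) (cQ₂ n) x.1| * ((n : ℝ) ^ 8)⁻¹ * ((1 / 2 : ℝ) * ((4 : ℝ) * ((4 : ℝ) *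
        (E * Cw n) * Zl 4 (δ n)) * Zl 4 (δ n))) * (S * (n : ℝ) ^ (4 - 0 + 2))
      = (|ωgl n * slotWt (cE₂ n) (cJ4 n) (cΛ₂ n) (cR₂ n) (cQ₂ n) x.1| * Cw n * (n : ℝ) ^ 6) *
          ((8 * E * S) * ((Zl 4 (δ n) * Zl 4 (δ n)) * ((n : ℝ) ^ 8)⁻¹)) := by
    rw [abs_mul]; ring
  rw [e]
  calc (|ωgl n * slotWt (cE₂ n) (cJ4 n) (cΛ₂ n) (cR₂ n) (cQ₂ n) x.1| * Cw n * (n : ℝ) ^ 6) *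
        ((8 * E * S) * ((Zl 4 (δ n) * Zl 4 (δ n)) * ((n : ℝ) ^ 8)⁻¹))
      ≤ k * ((8 * E * S) * ((((1 + 2 / δ₀) ^ 4 * (n : ℝ) ^ 4) * ((1 + 2 / δ₀) ^ 4 * (n : ℝ) ^ 4)) * ((n : ℝ) ^ 8)⁻¹)) :=
        mul_le_mul hkn (mul_le_mul_of_nonneg_left (mul_le_mul_of_nonneg_right hZsq (by positivity)) (by positivity)) (by positivity) hk0
    _ = k * E * (8 * (1 + 2 / δ₀) ^ 8) * S := by field_simp

/-! ## §4 The envelope in the block metric -/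

/-- [folklore] **«L-TAD» UNDER A BLOCK-METRIC DECAYING ENVELOPE** (the currency of the projector letters `e^{−δ·dist(blk ·, blk ·)}`): if slot `s` satisfies
`BiLoc (W_s κ u l u′) u u′ (Cw n·e^{−θ·dist(blk u, blk u′)}) (δ n)` with `θ > 0`, `δ n > 0`, `δ₀∕n ≤ δ n`, `Cw n ≥ 0`, and the units line `|ωgl n·c_s n|·Cw n·n⁶ ≤ k`
holds for `n ≥ 2`, then the `hLoc` clause of `Sum.inl (s, r)` holds with `CL := (k·e^{θ})·(E + E)·(8·(1+2∕δ₀)⁸)·S₀(θ)` (block decay ⟹ site damping at rate `θ∕n`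
with the factor `e^{θ}`, `exp_blockDecay_le_siteDamped`; then §3). -/
theorem hLoc_tad_of_blockDecay_scaling (x : Fin 5 × Fin 3) (ha : 0 < a) (hθ : 0 < θ) (hδ : ∀ n, 0 < δ n) {δ₀ k : ℝ} (hδ₀ : 0 < δ₀)
    (hδge : ∀ n : ℕ, δ₀ / n ≤ δ n) (hCw : ∀ n, 0 ≤ Cw n)
    (hW : ∀ n κ u l u', BiLoc (slotTab (WE n) (WJ n) (WΛ n) (WR n) (WQ n) x.1 κ u l u') u u'
      (Cw n * Real.exp (-(θ * dist (blk (n - 1) u) (blk (n - 1) u')))) (δ n))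
    (hk : ∀ n : ℕ, 2 ≤ n → |ωgl n * slotWt (cE₂ n) (cJ4 n) (cΛ₂ n) (cR₂ n) (cQ₂ n) x.1| * Cw n * (n : ℝ) ^ 6 ≤ k) :
    ∀ n : ℕ, 2 ≤ n → ∀ [NeZero n],
      |∑ b ∈ (univ : Finset (Fin 4 → Fin n)).image resSite, ((n : ℝ) ^ 4)⁻¹ *
        fullSum (fun w : Pt => restK' n a (gfrz n a b) (cE n) (cΛ n) (cR n) (cK n) (cQ n) (cE₂ n) (cJ4 n) (cΛ₂ n) (cR₂ n) (cQ₂ n) (x₀ n)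
          (WE n) (WJ n) (WΛ n) (WR n) (WQ n) (ωgl n) (ωgh n) ((n : ℝ) ^ 8) N μ ν b (Sum.inl x) w)| ≤
        (k * Real.exp θ) * ((cG0 4 + (woodburyDc 0 + ellD0 4 a) + ellD0 4 a) + (cG0 4 + (woodburyDc 0 + ellD0 4 a) + ellD0 4 a)) *
          (8 * (1 + 2 / δ₀) ^ 8) *
          (2 * (2 : ℕ).factorial * (2 / θ) ^ 2 * (1 + 2 * (4 : ℕ) * 3 ^ (4 - 1) * ((4 - 1 - 0).factorial * (4 / θ) ^ (4 - 1 - 0) * (1 + 4 / θ)))) := by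
  -- block decay ⟹ site damping, uniformly in n (at n = 0 the site rate is 0 and the bound is trivial)
  have henv : ∀ (n : ℕ) (u u' : Site 4), Real.exp (-(θ * dist (blk (n - 1) u) (blk (n - 1) u')))
      ≤ Real.exp θ * Real.exp (-(θ / n) * supNorm (u - u')) := by
    intro n u u'
    rcases Nat.eq_zero_or_pos n with hn | hn
    · subst hn
      have e : Real.exp (-(θ / ((0 : ℕ) : ℝ)) * supNorm (u - u')) = 1 := by simp
      rw [e, mul_one]
      exact (Real.exp_le_one_iff.mpr (neg_nonpos.mpr (mul_nonneg hθ.le dist_nonneg))).trans (Real.one_le_exp hθ.le)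
    · haveI : NeZero n := ⟨hn.ne'⟩
      have h := exp_blockDecay_le_siteDamped n hθ.le u u'
      rwa [← neg_sub u u', PoissonInterior.supNorm_neg] at h
  have hW' : ∀ n κ u l u', BiLoc (slotTab (WE n) (WJ n) (WΛ n) (WR n) (WQ n) x.1 κ u l u') u u'
      ((Cw n * Real.exp θ) * Real.exp (-(θ / n) * supNorm (u - u'))) (δ n) := by
    intro n κ u l u' x' y a' b'
    refine (hW n κ u l u' x' y a' b').trans (mul_le_mul_of_nonneg_right ?_ (Real.exp_pos _).le)
    rw [mul_assoc]
    exact mul_le_mul_of_nonneg_left (henv n u u') (hCw n)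
  have hCw' : ∀ n, 0 ≤ Cw n * Real.exp θ := fun n => mul_nonneg (hCw n) (Real.exp_pos θ).le
  have hk' : ∀ n : ℕ, 2 ≤ n → |ωgl n * slotWt (cE₂ n) (cJ4 n) (cΛ₂ n) (cR₂ n) (cQ₂ n) x.1| * (Cw n * Real.exp θ) * (n : ℝ) ^ 6 ≤ k * Real.exp θ := by
    intro n hn
    have h := mul_le_mul_of_nonneg_right (hk n hn) (Real.exp_pos θ).le
    refine le_trans (le_of_eq ?_) h
    ring
  exact hLoc_tad_of_decay_scaling x ha hθ hδ hδ₀ hδge hCw' hW' hk'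

end Along

end Summit.QuantumFields.BalabanUV.Beta.D1BFx.LocalTadpoleRowsDecay

end
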